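import Literature.Computability.Complexity.MurrayWilliams2018Simulation
import Literature.Computability.Complexity.HardnessVsRandomnessTests
import Literature.Computability.Complexity.BranchingFn
import HarnessLib

/-!
# Murray–Williams 2018, Lemma 4.1 (proof) with a polylogarithmic-seed generator: the behaviour of
# the derandomized simulation `N` and its correctness on the good lengths

Companion of `MurrayWilliams2018Simulation.lean` (`MWSim.*`: the behaviour of the simulation `N`
of the printed proof of Murray–Williams' Lemma 4.1, STOC 2018 / ECCC TR17-188 pp. 13–14, for a
table generator with seeds of length `γ · M` at table scale `M` — the seed length of Umans'
generator, the source's Thm. 2.1). The tree's PROVED generator is the one of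
Impagliazzo–Kabanets–Wigderson's Thm. 11 (`IKW2002_thm11_tableGenerator`,
`IKWGeneratorsProofs.lean`): seeds of length `c · M^{sx}` (`sx = 4`) and the hardness requirement
`(nb + M)ᶜ < CC(table)` for fooling size-`nb` tests. This file is the variant of `MWSim` for
that seed length (serving the polylogarithmic-seed form of Lemma 4.1,
`MurrayWilliams2018EasyWitnessAssemblyQP.lean` / `MurrayWilliams2018Lemma13QP.lean`), with two
further points the class-level assembly needs:

* the advice of a word is `β = ⟨⟨x_h, α⟩, junk⟩` (the format of `MWSimN`,
  `MurrayWilliams2018SimulationMachine.lean`), so that it can be padded to an exact length as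
  `DecidesOnWithAdvice` (`MurrayWilliams2018EasyWitnessAssembly.lean`) demands;
* **the capped generator** `capGen F`: on `⟨T, ⟨1^{nb}, s⟩⟩` it returns the seed `s` itself when
  `nb ≤ |s|` and `F ⟨T, ⟨1^{nb}, s⟩⟩` otherwise. With seeds of length `σ = c · M^{sx}` this makes
  the hardness requirement INDEPENDENT of the table scale `M` (i.e. of the time bound `t`):
  either `σ ≥ nb` and the first `nb` output bits are exactly uniform (a projection of a uniform
  seed: advantage `0`, `card_filter_comp_castLE_div` of `HardnessVsRandomnessTests.lean`), or
  `σ < nb`, whence `M ≤ σ < nb` and IKW's requirement is implied by `(2 nb)ᶜ < CC(table)`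
  (`isSizePseudorandom_capGen`). (The printed proof has no such case distinction because Umans'
  requirement `CC(Y) ≥ sᵍ` does not involve `|Y|`.)

Contents (all proved; definitions with bodies; no named fact):

* `capGen F`, `capGen_of_le`, `capGen_of_lt`, `capGen_mem_FP`, `tableGenerator_capGen_of_lt`,
  `isSizePseudorandom_proj`, `isSizePseudorandom_capGen`;
* `MWSimQ.seedLen`, `MWSimQ.xOf/xhOf/alphaOf`, `MWSimQ.verdictBit`, `MWSimQ.simLang` — the
  behaviour of `N` on `w = ⟨x, ⟨⟨x_h, α⟩, junk⟩⟩` and the guess `u`: keep `u ↾ U(w) = ⟨y', z'⟩`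
  (`U w` the witness window of the word),
  cut `y = y' ↾ (c_V t|x_h| + c_V)` (`MWSim.witOf`), table `T = y 1 0⋯0` of `2^M` bits,
  `M = ⌈log₂ (|y| + 1)⌉` — the padded table `padTable y` DEFINING Murray–Williams' `CC(y)`
  (`stringCC`, `MurrayWilliams2018StringComplexity.lean`), so that the hardness of a bad witness is
  the hardness of the table with no loss (`lt_circuitSizeOver_of_truthTable_eq_padTable`) —,
  Merlin's message `z = z' ↾ mv|x|` padded, reject unless `V(x_h, y)` accepts, accept iff a
  majority of the `2^{c M^{sx}}` seeds make Arthur accept (`MWSim.accCount`, generic in the table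
  and the seed length);
* `MWSimQ.verdictBit_eq_false`, `MWSimQ.verdictBit_eq_true`, `MWSimQ.mem_simLang_of_accepted`,
  `MWSimQ.not_mem_simLang_of_rejected` — correctness on the good inputs, word for word as in
  `MWSim` (the fooling step is `MWSim.abs_accCount_sub_le`, generic in the seed length).

## References

* C. D. Murray, R. R. Williams, *Circuit lower bounds for nondeterministic quasi-polytime: an easy
  witness lemma for NP and NQP*, STOC 2018 (ECCC TR17-188), proof of Lemma 4.1, pp. 13–14
  [MurrayWilliams2018].
* R. Impagliazzo, V. Kabanets, A. Wigderson, *In search of an easy witness*, JCSS 65 (2002), §2.4,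
  Thm. 11, Thm. 12 [ImpagliazzoKabanetsWigderson2002].
* S. Arora, B. Barak, *Computational Complexity: A Modern Approach*, CUP 2009, proof of Lemma 20.3
  (enumerate all seeds, majority vote), §1.3 [AroraBarakCC2009].
-/

noncomputable section

namespace Literature.Computability.Complexity

open _root_.Computability Finset Filter AMPlayer MetaComplexity Brick HashBricks

/-! ### The capped generator -/

/-- **The capped generator**: on `w = ⟨T, ⟨u, s⟩⟩` return the seed `s` when `|u| ≤ |s|` (enough
seed bits to serve as the coins themselves), else `F w`. [folklore] -/
def capGen (F : List Bool → List Bool) (w : List Bool) : List Bool :=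
  if (fstF (sndF w)).length ≤ (sndF (sndF w)).length then sndF (sndF w) else F w

/-- The capped generator on long seeds. [folklore] -/
theorem capGen_of_le (F : List Bool → List Bool) {T u s : List Bool} (h : u.length ≤ s.length) :
    capGen F (boolPair T (boolPair u s)) = s := by
  simp [capGen, fstF_boolPair, sndF_boolPair, h]

/-- The capped generator on short seeds. [folklore] -/
theorem capGen_of_lt (F : List Bool → List Bool) {T u s : List Bool} (h : s.length < u.length) :
    capGen F (boolPair T (boolPair u s)) = F (boolPair T (boolPair u s)) := by
  simp [capGen, fstF_boolPair, sndF_boolPair, Nat.not_le.2 h]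

/-- The test `w ↦ [ |fst (snd w)| ≤ |snd (snd w)| ]`. [folklore] -/
def capTest : List Bool → List Bool :=
  ltFn ∘ fanoutFn (lenBinF ∘ fstF ∘ sndF) (addFn ∘ fanoutFn (lenBinF ∘ sndF ∘ sndF) fun _ => encodeNat 1)

/-- Value of the test. [folklore] -/
theorem capTest_apply (w : List Bool) :
    capTest w = [decide ((fstF (sndF w)).length ≤ (sndF (sndF w)).length)] := by
  simp only [capTest, Function.comp_apply, fanoutFn_apply, lenBinF_apply, addFn_boolPair,
    ltFn_boolPair, bitsToNat_encodeNat, Nat.lt_succ_iff]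

/-- `capTest ∈ FP`. [folklore] -/
theorem capTest_mem_FP : capTest ∈ FP :=
  comp_mem_FP ltFn_mem_FP
    (fanoutFn_mem_FP (comp_mem_FP lenBinF_mem_FP (comp_mem_FP fstF_mem_FP sndF_mem_FP))
      (comp_mem_FP addFn_mem_FP
        (fanoutFn_mem_FP (comp_mem_FP lenBinF_mem_FP (comp_mem_FP sndF_mem_FP sndF_mem_FP))
          (const_mem_FP _))))

/-- The capped generator as a branching brick. [folklore] -/
theorem capGen_eq_iteFn (F : List Bool → List Bool) :
    capGen F = iteFn capTest (sndF ∘ sndF) F := by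
  funext w
  by_cases h : (fstF (sndF w)).length ≤ (sndF (sndF w)).length
  · rw [iteFn_apply_true (by rw [capTest_apply, decide_eq_true h]), capGen, if_pos h]
    rfl
  · rw [iteFn_apply_false (by rw [capTest_apply, decide_eq_false h]), capGen, if_neg h]

/-- **`capGen F ∈ FP` for `F ∈ FP`.** [cite: AroraBarakCC2009, §1.3] -/
theorem capGen_mem_FP {F : List Bool → List Bool} (hF : F ∈ FP) : capGen F ∈ FP := by
  rw [capGen_eq_iteFn]
  exact iteFn_mem_FP capTest_mem_FP (comp_mem_FP sndF_mem_FP sndF_mem_FP) hF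

/-- On short seeds the capped table generator is the table generator of `F`. [folklore] -/
theorem tableGenerator_capGen_of_lt {m : ℕ} (F : List Bool → List Bool) (f : (Fin m → Bool) → Bool)
    {k n : ℕ} (h : k < n) : tableGenerator (capGen F) f k n = tableGenerator F f k n := by
  funext s i
  rw [tableGenerator_apply, tableGenerator_apply, capGen_of_lt]
  rw [List.length_ofFn, OracleCompose.unaryEncodeNat_eq_replicate, List.length_replicate]
  exact h

/-- On long seeds the capped table generator outputs the first `n` seed bits. [folklore] -/
theorem tableGenerator_capGen_of_le {m : ℕ} (F : List Bool → List Bool) (f : (Fin m → Bool) → Bool)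
    {k n : ℕ} (h : n ≤ k) (s : Fin k → Bool) (i : Fin n) :
    tableGenerator (capGen F) f k n s i = s (Fin.castLE h i) := by
  rw [tableGenerator_apply, capGen_of_le F (by
    rw [List.length_ofFn, OracleCompose.unaryEncodeNat_eq_replicate, List.length_replicate]; exact h)]
  rw [List.getD_eq_getElem _ _ (by rw [List.length_ofFn]; exact i.isLt.trans_le h), List.getElem_ofFn]
  rfl

/-- **A projection of a uniform seed is exactly uniform**: the generator `s ↦ s|_{[n]}`
(`n ≤ k`) has advantage `0` against every circuit, in particular it is `SIZE(n)`-pseudorandom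
(`card_filter_comp_castLE_div`). [folklore] -/
theorem isSizePseudorandom_proj {k n : ℕ} (h : n ≤ k) :
    IsSizePseudorandom (fun (s : Fin k → Bool) (i : Fin n) => s (Fin.castLE h i)) := by
  intro C _ _
  unfold prgAdvantage
  rw [card_filter_comp_castLE_div h (fun y : Fin n → Bool => C.eval y = true), sub_self, abs_zero]
  positivity

/-- **The capped generator is pseudorandom from a scale-free hardness requirement.** If `F` is
IKW's generator — for all `m, n, f`, `(n + m)^cI < CC(f)` makes `tableGenerator F f (cI · m^{sx}) n`
`SIZE(n)`-pseudorandom — then for `cI, M ≥ 1` and every `f : {0,1}^M → {0,1}` with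
`(2 nb)^{cI} < CC(f)`, `tableGenerator (capGen F) f (cI · M^{sx}) nb` is `SIZE(nb)`-pseudorandom:
if `nb ≤ cI · M^{sx}` it is a projection of the seed (`isSizePseudorandom_proj`); otherwise
`M ≤ cI · M^{sx} < nb`, so `(nb + M)^{cI} ≤ (2 nb)^{cI} < CC(f)` and it is `F`'s generator.
[cite: ImpagliazzoKabanetsWigderson2002, Thm. 11] -/
theorem isSizePseudorandom_capGen {F : List Bool → List Bool} {cI sx : ℕ}
    (hF : ∀ (m n : ℕ) (f : (Fin m → Bool) → Bool), (n + m) ^ cI < circuitSizeOver B2 f →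
      IsSizePseudorandom (tableGenerator F f (cI * m ^ sx) n))
    (hcI : 1 ≤ cI) (hsx : 1 ≤ sx) {M nb : ℕ} (f : (Fin M → Bool) → Bool)
    (hf : (2 * nb) ^ cI < circuitSizeOver B2 f) :
    IsSizePseudorandom (tableGenerator (capGen F) f (cI * M ^ sx) nb) := by
  rcases le_or_gt nb (cI * M ^ sx) with h | h
  · have e : tableGenerator (capGen F) f (cI * M ^ sx) nb =
        fun (s : Fin (cI * M ^ sx) → Bool) (i : Fin nb) => s (Fin.castLE h i) :=
      funext fun s => funext fun i => tableGenerator_capGen_of_le F f h s i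
    rw [e]
    exact isSizePseudorandom_proj h
  · rw [tableGenerator_capGen_of_lt F f h]
    refine hF M nb f (lt_of_le_of_lt ?_ hf)
    have hM : M ≤ cI * M ^ sx :=
      calc M = 1 * M ^ 1 := by rw [one_mul, pow_one]
        _ ≤ cI * M ^ sx := by
          rcases Nat.eq_zero_or_pos M with rfl | hM
          · simp
          · exact Nat.mul_le_mul hcI (Nat.pow_le_pow_right hM hsx)
    refine Nat.pow_le_pow_left ?_ cI
    omega

/-! ### The behaviour of the simulation with seeds of length `c · M^{sx}` -/

namespace MWSimQ

section Defs

variable (t : ℕ → ℕ) {L : Language Bool} (V : NVerifier t L) (Ref : Language Bool)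
  (F : List Bool → List Bool) (c sx : ℕ) (mv : ℕ → ℕ) (Nb : ℕ → ℕ → ℕ) (U : List Bool → ℕ)

/-- The seed length for the hard witness `y`: `σ = c · M^{sx}`, `M = ⌈log₂ (|y| + 1)⌉` the scale
of the padded table `y 1 0⋯0` of `y` (`padTable`, `2^M` bits; Murray–Williams' `CC(y)` is the
circuit complexity of that table, `stringCC`). [cite: ImpagliazzoKabanetsWigderson2002, Thm. 11] -/
def seedLen (y : List Bool) : ℕ := c * Nat.clog 2 (y.length + 1) ^ sx

/-- The input `x` of a word `w = ⟨x, ⟨⟨x_h, α⟩, junk⟩⟩`. [folklore] -/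
def xOf (w : List Bool) : List Bool := fstF w
/-- The bad input `x_h` carried by the advice of `w`. [folklore] -/
def xhOf (w : List Bool) : List Bool := fstF (fstF (sndF w))
/-- The protocol's advice `α` carried by the advice of `w`. [folklore] -/
def alphaOf (w : List Bool) : List Bool := sndF (fstF (sndF w))

/-- **The behaviour of the simulation `N`** on the word `w = ⟨x, ⟨⟨x_h, α⟩, junk⟩⟩` and the guess
`u`: keep `u ↾ U(w) = ⟨y', z'⟩` (`U w` the witness window of the word); the witness
`y = y' ↾ (c_V t|x_h| + c_V)` (`MWSim.witOf`), the table
`T = y 1 0⋯0` (`padTable y`, `2^M` bits), Merlin's message `z = z' ↾ mv|x|` (padded); reject unless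
`V(x_h, y)` accepts; accept iff a majority of the `2^{c M^{sx}}` seeds make Arthur accept
`⟨⟨⟨x, α⟩, z⟩, G_T(ρ) ↾ mv|x|⟩` (`MWSim.accCount`). [cite: MurrayWilliams2018, Lemma 4.1 (proof)] -/
def verdictBit (w u : List Bool) : Bool :=
  V.rel (xhOf w) (MWSim.witOf t V (xhOf w) (fstF (u.take (U w)))) &&
    decide (2 ^ seedLen c sx (MWSim.witOf t V (xhOf w) (fstF (u.take (U w)))) <
      2 * MWSim.accCount Ref F (xOf w) (alphaOf w)
        (List.takeD (mv (xOf w).length) (sndF (u.take (U w))) false)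
        (padTable (MWSim.witOf t V (xhOf w) (fstF (u.take (U w)))))
        (seedLen c sx (MWSim.witOf t V (xhOf w) (fstF (u.take (U w)))))
        (Nb (xOf w).length (alphaOf w).length) (mv (xOf w).length))

/-- **The simulation language**: words having a guess of length `≤ U w` accepted by `N` (the
window `U` is a function of the WORD — of its fields `x_h`, `x` —, as the machine's
`2 (c_V t|x_h| + c_V) + 2 + m|x|`).
[cite: MurrayWilliams2018, Lemma 4.1 (proof)] -/
def simLang : Language Bool :=
  {w | ∃ u : List Bool, u.length ≤ U w ∧ verdictBit t V Ref F c sx mv Nb U w u = true}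

/-- Unfolding of `seedLen` (definitional). [folklore] -/
theorem seedLen_apply (y : List Bool) : seedLen c sx y = c * Nat.clog 2 (y.length + 1) ^ sx := rfl

end Defs

/-! ### The fields of a word -/

section Fields

variable (x xh α j : List Bool)

/-- `xOf ⟨x, ⟨⟨x_h, α⟩, j⟩⟩ = x`. [folklore] -/
@[simp] theorem xOf_word : xOf (boolPair x (boolPair (boolPair xh α) j)) = x := fstF_boolPair _ _
/-- `xhOf ⟨x, ⟨⟨x_h, α⟩, j⟩⟩ = x_h`. [folklore] -/
@[simp] theorem xhOf_word : xhOf (boolPair x (boolPair (boolPair xh α) j)) = xh := by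
  simp [xhOf, fstF_boolPair, sndF_boolPair]
/-- `alphaOf ⟨x, ⟨⟨x_h, α⟩, j⟩⟩ = α`. [folklore] -/
@[simp] theorem alphaOf_word : alphaOf (boolPair x (boolPair (boolPair xh α) j)) = α := by
  simp [alphaOf, fstF_boolPair, sndF_boolPair]

end Fields

/-- **Hard strings are hard tables**: if `CC(y) > H` (`stringCC`) then every function whose truth
table is the padded table of `y` has circuit complexity `> H` (it IS the function defining
`CC(y)`, `truthTable_injective`). [cite: MurrayWilliams2018, §2] -/
theorem lt_circuitSizeOver_of_truthTable_eq_padTable {y : List Bool} {H : ℕ} (h : H < stringCC y)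
    (f : (Fin (Nat.clog 2 (y.length + 1)) → Bool) → Bool) (hf : truthTable f = padTable y) :
    H < circuitSizeOver B2 f := by
  have e : f = ofTruthTable (padTable y) (length_padTable y) :=
    truthTable_injective (by rw [hf, truthTable_ofTruthTable])
  rw [e]
  exact h

/-! ### Correctness on the good inputs -/

section Correct

variable {t : ℕ → ℕ} {L : Language Bool} (V : NVerifier t L) {Ref : Language Bool}
  {F : List Bool → List Bool} (c sx : ℕ) (mv : ℕ → ℕ) (Nb : ℕ → ℕ → ℕ) (U : List Bool → ℕ)

/-- **Soundness on a good input.** On the word `⟨x, ⟨⟨x_h, α⟩, j⟩⟩` — where every accepted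
admissible witness of `x_h` has `CC > H`, hard functions at every scale `M` arm
`SIZE(nb)`-pseudorandom generators with seeds of length `c M^{sx}`, Arthur's predicates are
circuits of size `≤ nb` (`nb ≥ 7`) — if EVERY message of Merlin is accepted with probability
`≤ 1/3`, then `N` rejects every guess. [cite: MurrayWilliams2018, Lemma 4.1 (proof)] -/
theorem verdictBit_eq_false (x xh α j : List Bool) {H : ℕ}
    (hbad : ∀ y : List Bool, y.length ≤ MWSim.bound t V xh.length → V.rel xh y = true →
      H < stringCC y)
    (hfool : ∀ (M : ℕ) (f : (Fin M → Bool) → Bool), H < circuitSizeOver B2 f →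
      IsSizePseudorandom (tableGenerator F f (c * M ^ sx) (Nb x.length α.length)))
    (hmnb : mv x.length ≤ Nb x.length α.length) (h7 : 7 ≤ Nb x.length α.length)
    (hC : ∀ z : List Bool, z.length = mv x.length →
      ∃ C : Circuit (Fin (Nb x.length α.length)), C.IsOver B2 ∧ C.size ≤ Nb x.length α.length ∧
        ∀ r, C.eval r = Ref.boolIndicator (boolPair (boolPair (boolPair x α) z)
          (List.ofFn fun i : Fin (mv x.length) => r (Fin.castLE hmnb i))))
    (hrej : ∀ z : List Bool, z.length = mv x.length →
      uniformProb (mv x.length) {r | boolPair (boolPair (boolPair x α) z) r ∈ Ref} ≤ 1 / 3)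
    (u : List Bool) :
    verdictBit t V Ref F c sx mv Nb U (boolPair x (boolPair (boolPair xh α) j)) u = false := by
  set w := boolPair x (boolPair (boolPair xh α) j) with hw
  rw [verdictBit]
  simp only [hw, xOf_word, xhOf_word, alphaOf_word]
  rw [← hw]
  set y := MWSim.witOf t V xh (fstF (u.take (U w))) with hy
  cases hrel : V.rel xh y with
  | false => rfl
  | true =>
    simp only [Bool.true_and, decide_eq_false_iff_not, not_lt]
    set z := List.takeD (mv x.length) (sndF (u.take (U w))) false with hz
    have hzlen : z.length = mv x.length := List.takeD_length _ _ _
    have hhard : ∀ f : (Fin (Nat.clog 2 (y.length + 1)) → Bool) → Bool, truthTable f = padTable y →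
        H < circuitSizeOver B2 f :=
      lt_circuitSizeOver_of_truthTable_eq_padTable (hbad y (MWSim.length_witOf_le V _ _) hrel)
    obtain ⟨C, hB, hs, hCe⟩ := hC z hzlen
    have habs := MWSim.abs_accCount_sub_le (hfool _) x α z (padTable y) (length_padTable y) hhard
      hmnb C hB hs hCe
    have hPr := hrej z hzlen
    have hlt : (MWSim.accCount Ref F x α z (padTable y) (seedLen c sx y) (Nb x.length α.length)
        (mv x.length) : ℝ) / 2 ^ seedLen c sx y < 1 / 2 :=
      lt_half_of_abs_sub_le habs hPr (one_div_lt_one_sixth h7)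
    by_contra hle
    rw [not_le, two_pow_lt_two_mul_iff] at hle
    linarith

/-- **Completeness on a good input.** Under the same hypotheses, if some message `z` of Merlin
(of the move length) is accepted with probability `≥ 2/3` and `y₀` is an accepted witness of `x_h`,
then the guess `⟨y₀, z⟩` — kept whole when `2|y₀| + |z| + 2 ≤ U w` — makes `N` accept.
[cite: MurrayWilliams2018, Lemma 4.1 (proof)] -/
theorem verdictBit_eq_true (x xh α j : List Bool) {H : ℕ}
    (hbad : ∀ y : List Bool, y.length ≤ MWSim.bound t V xh.length → V.rel xh y = true →
      H < stringCC y)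
    (hfool : ∀ (M : ℕ) (f : (Fin M → Bool) → Bool), H < circuitSizeOver B2 f →
      IsSizePseudorandom (tableGenerator F f (c * M ^ sx) (Nb x.length α.length)))
    (hmnb : mv x.length ≤ Nb x.length α.length) (h7 : 7 ≤ Nb x.length α.length)
    (hC : ∀ z : List Bool, z.length = mv x.length →
      ∃ C : Circuit (Fin (Nb x.length α.length)), C.IsOver B2 ∧ C.size ≤ Nb x.length α.length ∧
        ∀ r, C.eval r = Ref.boolIndicator (boolPair (boolPair (boolPair x α) z)
          (List.ofFn fun i : Fin (mv x.length) => r (Fin.castLE hmnb i))))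
    {z : List Bool} (hzl : z.length = mv x.length)
    (hacc : 2 / 3 ≤ uniformProb (mv x.length) {r | boolPair (boolPair (boolPair x α) z) r ∈ Ref})
    {y₀ : List Bool} (hy₀ : y₀.length ≤ MWSim.bound t V xh.length) (hrel : V.rel xh y₀ = true)
    (hU : 2 * y₀.length + mv x.length + 2 ≤ U (boolPair x (boolPair (boolPair xh α) j))) :
    verdictBit t V Ref F c sx mv Nb U (boolPair x (boolPair (boolPair xh α) j)) (boolPair y₀ z) =
      true := by
  set w := boolPair x (boolPair (boolPair xh α) j) with hw
  set u := boolPair y₀ z with hu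
  -- the honest guess is kept whole
  have hulen : u.length ≤ U w := by
    simp only [hu, length_boolPair, hzl]
    omega
  have htake : u.take (U w) = u := List.take_of_length_le hulen
  have hwit : MWSim.witOf t V xh (fstF u) = y₀ := by
    rw [hu, fstF_boolPair, MWSim.witOf, List.take_of_length_le hy₀]
  have hmsg : List.takeD (mv x.length) (sndF u) false = z := by
    rw [hu, sndF_boolPair, List.takeD_eq_take _ hzl.ge, List.take_of_length_le hzl.le]
  rw [verdictBit]
  simp only [hw, xOf_word, xhOf_word, alphaOf_word]
  rw [← hw]
  simp only [htake, hwit, hrel, hmsg, Bool.true_and, decide_eq_true_eq]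
  have hhard : ∀ f : (Fin (Nat.clog 2 (y₀.length + 1)) → Bool) → Bool, truthTable f = padTable y₀ →
      H < circuitSizeOver B2 f :=
    lt_circuitSizeOver_of_truthTable_eq_padTable (hbad y₀ hy₀ hrel)
  obtain ⟨C, hB, hs, hCe⟩ := hC z hzl
  have habs := MWSim.abs_accCount_sub_le (hfool _) x α z (padTable y₀) (length_padTable y₀) hhard
    hmnb C hB hs hCe
  have hgt : (1 : ℝ) / 2 < (MWSim.accCount Ref F x α z (padTable y₀) (seedLen c sx y₀)
      (Nb x.length α.length) (mv x.length) : ℝ) / 2 ^ seedLen c sx y₀ :=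
    half_lt_of_abs_sub_le habs hacc (one_div_lt_one_sixth h7)
  rwa [two_pow_lt_two_mul_iff]

/-- **`N` decides the promise language on the good inputs** (completeness half): on
`w = ⟨x, ⟨⟨x_h, α⟩, j⟩⟩` with `x_h ∈ L` bad at level `H`, hard functions arming the generator,
Arthur's predicates small circuits, and the kept length covering the honest guesses, if some
message of Merlin (of the move length) is accepted with probability `≥ 2/3` then `w ∈ simLang`.
[cite: MurrayWilliams2018, Lemma 4.1 (proof)] -/
theorem mem_simLang_of_accepted (x xh α j : List Bool) {H : ℕ} (hxh : xh ∈ L)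
    (hbad : ∀ y : List Bool, y.length ≤ MWSim.bound t V xh.length → V.rel xh y = true →
      H < stringCC y)
    (hfool : ∀ (M : ℕ) (f : (Fin M → Bool) → Bool), H < circuitSizeOver B2 f →
      IsSizePseudorandom (tableGenerator F f (c * M ^ sx) (Nb x.length α.length)))
    (hmnb : mv x.length ≤ Nb x.length α.length) (h7 : 7 ≤ Nb x.length α.length)
    (hC : ∀ z : List Bool, z.length = mv x.length →
      ∃ C : Circuit (Fin (Nb x.length α.length)), C.IsOver B2 ∧ C.size ≤ Nb x.length α.length ∧
        ∀ r, C.eval r = Ref.boolIndicator (boolPair (boolPair (boolPair x α) z)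
          (List.ofFn fun i : Fin (mv x.length) => r (Fin.castLE hmnb i))))
    (hU : 2 * MWSim.bound t V xh.length + mv x.length + 2 ≤
      U (boolPair x (boolPair (boolPair xh α) j)))
    (hval : ∃ z : List Bool, z.length = mv x.length ∧
      (2 / 3 : ℝ) ≤ uniformProb (mv x.length) {r | boolPair (boolPair (boolPair x α) z) r ∈ Ref}) :
    boolPair x (boolPair (boolPair xh α) j) ∈ simLang t V Ref F c sx mv Nb U := by
  obtain ⟨z, hzl, hz⟩ := hval
  obtain ⟨y₀, hy₀, hrel⟩ := (V.mem_iff xh).1 hxh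
  have hy₀' : y₀.length ≤ MWSim.bound t V xh.length := hy₀
  have hU' : 2 * y₀.length + mv x.length + 2 ≤ U (boolPair x (boolPair (boolPair xh α) j)) :=
    le_trans (by omega) hU
  refine ⟨boolPair y₀ z, ?_,
    verdictBit_eq_true V c sx mv Nb U x xh α j hbad hfool hmnb h7 hC hzl hz hy₀' hrel hU'⟩
  have h1 : (boolPair y₀ z).length = 2 * y₀.length + mv x.length + 2 := by
    simp only [length_boolPair, hzl]; ring
  rw [h1]
  exact hU'

/-- **`N` decides the promise language on the good inputs** (soundness half): if every message is
accepted with probability `≤ 1/3` then `w ∉ simLang`. [cite: MurrayWilliams2018, Lemma 4.1 (proof)] -/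
theorem not_mem_simLang_of_rejected (x xh α j : List Bool) {H : ℕ}
    (hbad : ∀ y : List Bool, y.length ≤ MWSim.bound t V xh.length → V.rel xh y = true →
      H < stringCC y)
    (hfool : ∀ (M : ℕ) (f : (Fin M → Bool) → Bool), H < circuitSizeOver B2 f →
      IsSizePseudorandom (tableGenerator F f (c * M ^ sx) (Nb x.length α.length)))
    (hmnb : mv x.length ≤ Nb x.length α.length) (h7 : 7 ≤ Nb x.length α.length)
    (hC : ∀ z : List Bool, z.length = mv x.length →
      ∃ C : Circuit (Fin (Nb x.length α.length)), C.IsOver B2 ∧ C.size ≤ Nb x.length α.length ∧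
        ∀ r, C.eval r = Ref.boolIndicator (boolPair (boolPair (boolPair x α) z)
          (List.ofFn fun i : Fin (mv x.length) => r (Fin.castLE hmnb i))))
    (hval : ∀ z : List Bool, z.length = mv x.length →
      uniformProb (mv x.length) {r | boolPair (boolPair (boolPair x α) z) r ∈ Ref} ≤ 1 / 3) :
    boolPair x (boolPair (boolPair xh α) j) ∉ simLang t V Ref F c sx mv Nb U := by
  rintro ⟨u, -, hu⟩
  rw [verdictBit_eq_false V c sx mv Nb U x xh α j hbad hfool hmnb h7 hC hval u] at hu
  exact Bool.false_ne_true hu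

end Correct

end MWSimQ

end Literature.Computability.Complexity

end
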